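import Summits.QuantumFields.BalabanUV.T4Continuum.Support.NE3SmoothRightInverseCurl
import Summits.QuantumFields.BalabanUV.Beta.GAN24.DirichletExhaustionDeperiodise
import Literature.NumberTheory.LFunctions.PlateauMollifier
import Literature.MathematicalPhysics.QuantumFieldTheory.Balaban1983to89.B4TorusKernel
import HarnessLib

/-!
# NE7CentredRepresentative — BOOKKEEPING OF THE CENTRED REPRESENTATIVE `w(v) = translate N v (centreVec N v)` of lit-balaban's `B4TorusKernel.MultiPeriod` and of the
# lattice sup norm: `w` is `N`-periodic (`w(v + N•m) = w(v)`), fixes strictly centred vectors, has `supNorm w(v) = torusSupNorm v`; `supNorm` moves by at most `1` along a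
# bond and takes integer values; the clamp `max 0 (min 1 ·)` is 1-Lipschitz; the flat curl of a weighted 1-form `χ·a` expands as `χ·curl a + (δχ)·a`

Cell `pub-balaban`, rung (B)+1 sub-cell t4, lineage `b2b-balaban-t4-ne7-p1` (CRUX PROVER NE7 #1 = OWNER of row NE7), generation 89; memo
`t4/b2b-balaban-t4-ne7-p1-g89/COSTING-N1.md` §8 (β).  File F271a (helpers of F271b `NE7CoarseSplitExtension`; over lit-balaban's `B4TorusKernel.MultiPeriod` (`translate`, `centre`,
`centreVec`, `circAbs`, `torusSupNorm`, `abs_add_mul_centre`, `circAbs_of_centred`), `B4ContourShift.supNorm`, row NE3's `curlAt_flat_eq`).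

WHY.  The v4 split's near datum `φ₁` (F271b) is built on `ℤ^{d+1}` around a centre and read on the torus through the centred representative of `y − c`; its
periodicity, its agreement with `ψ` on a torus ball and the case analysis «deep inside ∕ at the seam» of its curl are exactly the facts below.
WHAT ([folklore]; 0 def, 0 sorry; dimension `d + 1`).  §1 `centre_eq_zero_of_small`, `centre_add_self`, `centre_add_mul`, `wrap_add_period`, `wrap_add_smul_vec`,
`wrap_eq_add_smul`, `wrap_eq_self_of_small`, `supNorm_wrap`, `wrap_centred` (`translate_const_eq_add_zsmul` is GAN24's); §2 `supNorm_le_iff`, `supNorm_add_e_le`, `supNorm_le_add_e`,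
`box_of_supNorm_le`, `supNorm_le_of_box`, `supNorm_int_gap`; §3 `clamp_mem` (the clamp's Lipschitz bound is `PlateauMollifier.abs_clamp_sub_clamp_le`); §4 `curlAt_flat_weight`.
HONEST FRAMING (page 1): integer bookkeeping; nothing of Bałaban's asserted; NOT (APE), NOT ONE-STEP, NOT NE7; spine 0∕9; finite T⁴ rung (B)+1 — NOT infinite volume, NOT
mass gap, NOT `BetaPertH`, NOT Clay.  Continuum YM on T⁴ ⇐ BetaPertH ∧ nine spine estimates (0/9 proved); BetaPertH ⇐ (D1) ∧ (D4) ∧ CAP+tail; G-an2-4 gates asym, D1 and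
NE2/3/4.
-/

set_option autoImplicit false

open scoped BigOperators Matrix.Norms.L2Operator
open NormedSpace Finset

namespace Summit.QuantumFields.BalabanUV.T4Continuum.NE7CentredRepresentative

open Literature.MathematicalPhysics.QuantumFieldTheory.Balaban1983to89
open B7Prop1Explicit B7Prop2Explicit
open B4ContourShift (supNorm abs_le_supNorm supNorm_nonneg)
open B4TorusKernel.MultiPeriod (translate translate_apply centreVec centre circAbs torusSupNorm abs_add_mul_centre circAbs_of_centred
  translate_centreVec_centred supNorm_translate_centreVec)
open T4AveragingDeficitWall (curlAt)
open AveragingDeficitPeriodicCounting (IsPeriodicDir)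
open BlockAveragePushDirSplit (flat)
open NE3SmoothLiftCurl (curlAt_flat_eq)
open NE3SmoothRightInverseCurl (curlAt_flat_dPot curlAt_flat_add)

noncomputable section

variable {d : ℕ} {n : Type*} [Fintype n] [DecidableEq n]

/-! ## §1 The centred representative -/

section Wrap

omit [Fintype n] [DecidableEq n]

/-- `centre N x = 0` when `2|x| < N`: the centred representative of a small integer is itself. [folklore] -/
theorem centre_eq_zero_of_small {N : ℕ} (hN : 1 ≤ N) {x : ℤ} (hx : 2 * |x| < N) : centre N x = 0 := by
  have h1 : |x + N * centre N x| = |x| := by rw [abs_add_mul_centre hN, circAbs_of_centred hN hx.le]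
  -- `x + Nc = ±x`
  rcases abs_eq_abs.mp h1 with h | h
  · have : (N : ℤ) * centre N x = 0 := by linarith
    rcases mul_eq_zero.mp this with h0 | h0
    · exfalso; have : (1 : ℤ) ≤ N := by exact_mod_cast hN
      linarith
    · exact h0
  · have h2 : (N : ℤ) * centre N x = -2 * x := by linarith
    have h3 : (N : ℤ) * |centre N x| = 2 * |x| := by
      have := congrArg (fun t : ℤ => |t|) h2
      simp only [abs_mul, Nat.abs_cast, abs_neg] at this
      simpa using this
    have h4 : (N : ℤ) * |centre N x| < N := by rw [h3]; exact hx
    have h5 : |centre N x| < 1 := by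
      by_contra hc
      push Not at hc
      have hNpos : (0 : ℤ) < N := by exact_mod_cast hN
      have : (N : ℤ) * 1 ≤ (N : ℤ) * |centre N x| := mul_le_mul_of_nonneg_left hc hNpos.le
      linarith
    have h6 := abs_lt.mp h5
    omega

/-- `centre N (x + N) = centre N x − 1`. [folklore] -/
theorem centre_add_self {N : ℕ} (hN : 1 ≤ N) (x : ℤ) : centre N (x + N) = centre N x - 1 := by
  have hN0 : (N : ℤ) ≠ 0 := by exact_mod_cast (show N ≠ 0 by omega)
  have h1 : (x + N) % (N : ℤ) = x % (N : ℤ) := Int.add_emod_right x N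
  have h2 : (x + N) / (N : ℤ) = x / (N : ℤ) + 1 := by
    rw [show x + (N : ℤ) = x + 1 * (N : ℤ) by ring, Int.add_mul_ediv_right _ _ hN0]
  unfold centre
  rw [h1, h2]
  split_ifs <;> ring

/-- The centred representative is `N`-periodic: `w(v + N e_i) = w(v)`. [folklore] -/
theorem wrap_add_period {N : ℕ} (hN : 1 ≤ N) (v : Fin (d + 1) → ℤ) (i : Fin (d + 1)) :
    translate (fun _ : Fin (d + 1) => N) (v + (N : ℤ) • e i) (centreVec (fun _ : Fin (d + 1) => N) (v + (N : ℤ) • e i))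
      = translate (fun _ : Fin (d + 1) => N) v (centreVec (fun _ : Fin (d + 1) => N) v) := by
  funext j
  simp only [translate_apply, centreVec, Pi.add_apply, Pi.smul_apply, e_apply, smul_eq_mul]
  by_cases hj : j = i
  · rw [if_pos hj, mul_one, centre_add_self hN]; ring
  · rw [if_neg hj, mul_zero, add_zero]

/-- The centred representative differs from `v` by a period vector: `w(v) = v + N•m`. [folklore] -/
theorem wrap_eq_add_smul (N : ℕ) (v : Fin (d + 1) → ℤ) :
    translate (fun _ : Fin (d + 1) => N) v (centreVec (fun _ : Fin (d + 1) => N) v) = v + (N : ℤ) • centreVec (fun _ : Fin (d + 1) => N) v := by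
  funext j
  simp only [translate_apply, Pi.add_apply, Pi.smul_apply, smul_eq_mul]

/-- A vector that is strictly centred (`2|u_i| < N`) is its own centred representative. [folklore] -/
theorem wrap_eq_self_of_small {N : ℕ} (hN : 1 ≤ N) {u : Fin (d + 1) → ℤ} (hu : ∀ i, 2 * |u i| < N) :
    translate (fun _ : Fin (d + 1) => N) u (centreVec (fun _ : Fin (d + 1) => N) u) = u := by
  funext j
  simp only [translate_apply, centreVec, centre_eq_zero_of_small hN (hu j), mul_zero, add_zero]

/-- `supNorm w(v) = torusSupNorm v`. [folklore] -/
theorem supNorm_wrap {N : ℕ} (hN : 1 ≤ N) (v : Fin (d + 1) → ℤ) :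
    supNorm (translate (fun _ : Fin (d + 1) => N) v (centreVec (fun _ : Fin (d + 1) => N) v)) = torusSupNorm (fun _ : Fin (d + 1) => N) v :=
  supNorm_translate_centreVec (fun _ => hN) v

/-- `2|w(v)_i| ≤ N`. [folklore] -/
theorem wrap_centred {N : ℕ} (hN : 1 ≤ N) (v : Fin (d + 1) → ℤ) (i : Fin (d + 1)) :
    2 * |translate (fun _ : Fin (d + 1) => N) v (centreVec (fun _ : Fin (d + 1) => N) v) i| ≤ N :=
  translate_centreVec_centred (fun _ => hN) v i

end Wrap

/-! ## §2 `supNorm` bookkeeping -/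

section SupNorm

omit [Fintype n] [DecidableEq n]

/-- `supNorm x ≤ r ↔ ∀ i, |x i| ≤ r`. [folklore] -/
theorem supNorm_le_iff (x : Fin (d + 1) → ℤ) (r : ℝ) : supNorm x ≤ r ↔ ∀ i, ((|x i| : ℤ) : ℝ) ≤ r := by
  unfold supNorm
  rw [Finset.sup'_le_iff]
  exact ⟨fun h i => h i (Finset.mem_univ i), fun h i _ => h i⟩

/-- `supNorm (x + e_μ) ≤ supNorm x + 1`. [folklore] -/
theorem supNorm_add_e_le (x : Fin (d + 1) → ℤ) (μ : Fin (d + 1)) : supNorm (x + e μ) ≤ supNorm x + 1 := by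
  rw [supNorm_le_iff]
  intro i
  have h1 := abs_le_supNorm x i
  have h2 : |(x + e μ) i| ≤ |x i| + 1 := by
    rw [Pi.add_apply, e_apply]
    split_ifs
    · exact (abs_add_le _ _).trans (by simp)
    · simp
  have h3 : ((|(x + e μ) i| : ℤ) : ℝ) ≤ ((|x i| : ℤ) : ℝ) + 1 := by exact_mod_cast h2
  linarith

/-- `supNorm x ≤ supNorm (x + e_μ) + 1`. [folklore] -/
theorem supNorm_le_add_e (x : Fin (d + 1) → ℤ) (μ : Fin (d + 1)) : supNorm x ≤ supNorm (x + e μ) + 1 := by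
  rw [supNorm_le_iff]
  intro i
  have h1 := abs_le_supNorm (x + e μ) i
  have h2 : |x i| ≤ |(x + e μ) i| + 1 := by
    rw [Pi.add_apply, e_apply]
    split_ifs
    · have := abs_sub_abs_le_abs_sub (x i) (x i + 1)
      simp at this
      linarith [abs_nonneg (x i + 1)]
    · simp
  have h3 : ((|x i| : ℤ) : ℝ) ≤ ((|(x + e μ) i| : ℤ) : ℝ) + 1 := by exact_mod_cast h2
  linarith

end SupNorm

/-! ## §3 The clamp is 1-Lipschitz -/

omit [Fintype n] [DecidableEq n] in
/-- `0 ≤ clamp t ≤ 1`. [folklore] -/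
theorem clamp_mem (t : ℝ) : 0 ≤ max 0 (min 1 t) ∧ max 0 (min 1 t) ≤ 1 :=
  ⟨le_max_left _ _, max_le zero_le_one (min_le_left _ _)⟩

/-! ## §4 Algebra of the weighted curl, and the extension -/

/-- `curl_1(χ·a)(y) = χ(y)·curl_1 a(y) + (χ(y+e_μ) − χ(y))·a(y+e_μ,ν) − (χ(y+e_ν) − χ(y))·a(y+e_ν,μ)`. [folklore] -/
theorem curlAt_flat_weight (χ : Site (d + 1) → ℝ) (a : Site (d + 1) → Fin (d + 1) → Matrix n n ℂ) (y : Site (d + 1)) (μ ν : Fin (d + 1)) :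
    curlAt (flat (d := d + 1) (n := n)) (fun (x : Site (d + 1)) (κ : Fin (d + 1)) => χ x • a x κ) y μ ν
      = χ y • curlAt (flat (d := d + 1) (n := n)) a y μ ν + (χ (y + e μ) - χ y) • a (y + e μ) ν - (χ (y + e ν) - χ y) • a (y + e ν) μ := by
  rw [curlAt_flat_eq, curlAt_flat_eq]
  simp only [smul_sub, sub_smul]
  abel

/-- `centre N (x + N·k) = centre N x − k`. [folklore] -/
theorem centre_add_mul {N : ℕ} (hN : 1 ≤ N) (x k : ℤ) : centre N (x + N * k) = centre N x - k := by
  have hN0 : (N : ℤ) ≠ 0 := by exact_mod_cast (show N ≠ 0 by omega)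
  have h1 : (x + N * k) % (N : ℤ) = x % (N : ℤ) := Int.add_mul_emod_self_left x N k
  have h2 : (x + N * k) / (N : ℤ) = x / (N : ℤ) + k := Int.add_mul_ediv_left x k hN0
  unfold centre
  rw [h1, h2]
  split_ifs <;> ring

/-- `w(u + N•m) = w(u)`. [folklore] -/
theorem wrap_add_smul_vec {N : ℕ} (hN : 1 ≤ N) (u m : Fin (d + 1) → ℤ) :
    translate (fun _ : Fin (d + 1) => N) (u + (N : ℤ) • m) (centreVec (fun _ : Fin (d + 1) => N) (u + (N : ℤ) • m))
      = translate (fun _ : Fin (d + 1) => N) u (centreVec (fun _ : Fin (d + 1) => N) u) := by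
  funext j
  simp only [translate_apply, centreVec, Pi.add_apply, Pi.smul_apply, smul_eq_mul, centre_add_mul hN]
  ring

/-- Integer box form of `supNorm (y − c) ≤ k`. [folklore] -/
theorem box_of_supNorm_le {y c : Fin (d + 1) → ℤ} {k : ℕ} (h : supNorm (y - c) ≤ k) (i : Fin (d + 1)) :
    c i - k ≤ y i ∧ y i ≤ c i + k := by
  have h1 := (supNorm_le_iff _ _).mp h i
  have h2 : (|(y - c) i| : ℤ) ≤ k := by exact_mod_cast h1
  rw [Pi.sub_apply, abs_le] at h2
  constructor <;> linarith [h2.1, h2.2]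

/-- Conversely. [folklore] -/
theorem supNorm_le_of_box {y c : Fin (d + 1) → ℤ} {k : ℕ} (h : ∀ i, c i - k ≤ y i ∧ y i ≤ c i + k) : supNorm (y - c) ≤ k := by
  rw [supNorm_le_iff]
  intro i
  have h2 : (|(y - c) i| : ℤ) ≤ k := by rw [Pi.sub_apply, abs_le]; constructor <;> linarith [(h i).1, (h i).2]
  exact_mod_cast h2

/-- `supNorm` takes integer values: `k < supNorm x` for an integer `k` forces `k + 1 ≤ supNorm x`. [folklore] -/
theorem supNorm_int_gap (x : Fin (d + 1) → ℤ) {k : ℤ} (h : (k : ℝ) < supNorm x) : ((k : ℝ) + 1) ≤ supNorm x := by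
  obtain ⟨i, hi⟩ := B4ContourShift.exists_supNorm_eq x
  rw [hi] at h ⊢
  have h1 : k < |x i| := by exact_mod_cast h
  have h2 : k + 1 ≤ |x i| := h1
  exact_mod_cast h2

end

end Summit.QuantumFields.BalabanUV.T4Continuum.NE7CentredRepresentative
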